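import Mathlib
import Literature.Analysis.TotalPositivity.GeneralizedVandermonde
import Summits.ValiantsHypothesis.ValiantsHypothesis.Theorems.LacunarySymmetroidDoorA26ExtremalInverseDefs

/-!
# Route `LacunarySymmetroid` — crux `DoorA26` (stmt-ValiantsHypothesis-19979), line «extremal-inverse»:
# stub `stub_extremalInverse` (the extremal inverse = Chebyshev / Cramer), VERBATIM

Registered-for-planning line `Cruxes/DoorA26/Lines/extremal_inverse.lean` (ideator val-idea-4 g2, D-0145; crit-1 VERDICT #17
PASS-WITH-PRICE) reduces the crux `DoorA26` (`ζ_sym(2,6) ≤ 19`: every 6-term real symmetric `2 × 2` lacunary pencil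
determinant has at most 19 distinct positive zeros) to: the Gram form (proved in the line file), `stub_extremalInverse`
(THIS FILE), `onePositive` (proved in the line file) and the load-bearing signature law `stub_signatureLaw6` (OPEN, the bet).
This file proves `stub_extremalInverse` with exactly the registered signature, in the Theorems-side copy of the line's
vocabulary (`…DoorA26ExtremalInverseDefs`: `gramPoly`, `vdmMinor`, `extremalGram`, same bodies as the skeleton's):

* if the quadratic-form fewnomial `gramPoly d M = Σ_{i,j} M_{ij} X^{dᵢ+dⱼ}` of a symmetric `M` has at least twenty distinct
  positive roots, then the `21` pair sums `dᵢ + dⱼ` (`i ≤ j`) are pairwise distinct (Sidon) and sort as a strictly increasing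
  `E : Fin 21 → ℕ` with a symmetric surjective position map `σ` (`E (σ i j) = dᵢ + dⱼ`), and there are sorted positive roots
  `0 < r₀ < ⋯ < r₁₉` and `c ≠ 0` with `M = extremalGram E σ r c` (entry `(i,j)` = `c · (−1)^{σ i j} ·` the maximal minor of
  the `20 × 21` generalized Vandermonde `(r_a^{E_b})` with column `σ i j` deleted, halved off the diagonal).

PROOF.  (1) `gramPoly d M ≠ 0` (it has roots); its support lies in the image of the `21` ordered pairs `i ≤ j` under
`(i,j) ↦ dᵢ + dⱼ` (`gramPoly_support_subset`), and the tree's sparse Descartes rule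
(`Literature.Computability.AlgebraicComplexity.card_roots_toFinset_filter_pos_lt_card_support`: distinct positive zeros
`<` monomials) forces `#support ≥ 21`, so that map is injective on ordered pairs, i.e. the support is Sidon
(`sidon_of_injOn`), and its values sort (`exists_sortedEnum`, `Finset.orderIsoOfFin`).  (2) On a Sidon support the
coefficient of `X^{dᵢ+dⱼ}` is `M i i` / `2 M i j` (`gramPoly_coeff_pairSum`).  (3) The root-side parametrization of a
Descartes-sharp fewnomial, ALREADY IN THE TREE as `Literature.Analysis.TotalPositivity.exists_roots_coeff_eq_mul_signedMinor`
(Gantmacher Vol. 2 XIII §8 Ex. 1: generalized Vandermonde minors are positive; Pinkus 1985 III §1 Prop. 1.3: one-dimensional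
kernel), gives sorted positive roots `ρ` and `t ≠ 0` with `coeff (E u) = t · (−1)^u · minor_u(ρ)` for all `u`; reading the
matrix entries off these coefficients is `M = extremalGram E σ ρ t`.

HONEST FRAMING.  One support stub (size M, no new mathematics: Descartes + Cramer) of one line of an OPEN crux; it closes
NO item (`--supports stmt-ValiantsHypothesis-19979`, helper).  `DoorA26` stays open (the line's bet `stub_signatureLaw6` is
untouched here); nothing bears on `MatrixDescartes` (stmt-ValiantsHypothesis-18050), Conjecture B, or `VP ≠ VNP`.
Width seat val-width-19979-ei1 (cell valiant-width), 2026-08-28.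
-/

-- `Summit.ValiantsHypothesis.ValiantsHypothesis.…` repeats a component by the D-0017 layout
-- (single-conjunct summit), which the `dupNamespace` linter flags; the name is mandated.
set_option linter.dupNamespace false

namespace Summit.ValiantsHypothesis.ValiantsHypothesis.Theorems.LacunarySymmetroid.DoorA26.ExtremalInverse

open Polynomial Matrix Finset
open scoped BigOperators

/-! ### 1. Pair sums: the 21 ordered index pairs, Sidon supports, sorted enumeration -/

/-- There are `21 = C(7,2)` ordered index pairs `i ≤ j` in `Fin 6` — the `21` monomial slots `X^{dᵢ+dⱼ}` of a `(2,6)`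
pencil determinant (the finset `univ.filter (·.1 ≤ ·.2)` is written out everywhere; no definition is introduced). [folklore] -/
theorem card_pairDom : (Finset.univ.filter fun p : Fin 6 × Fin 6 => p.1 ≤ p.2).card = 21 := by decide

/-- Membership in the finset of ordered pairs. [folklore] -/
theorem mem_pairDom {a b : Fin 6} (h : a ≤ b) : (a, b) ∈ (Finset.univ.filter fun p : Fin 6 × Fin 6 => p.1 ≤ p.2) :=
  Finset.mem_filter.mpr ⟨Finset.mem_univ _, h⟩

/-- A symmetric pair function which is injective on the ordered pairs `i ≤ j` is injective on UNORDERED pairs: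
`s i j = s k l → {i,j} = {k,l}`. [folklore] -/
theorem sidon_of_injOn {β : Type*} (s : Fin 6 → Fin 6 → β) (hsymm : ∀ i j, s i j = s j i)
    (hinj : Set.InjOn (fun p : Fin 6 × Fin 6 => s p.1 p.2) ↑(Finset.univ.filter fun p : Fin 6 × Fin 6 => p.1 ≤ p.2)) :
    ∀ i j k l, s i j = s k l → (i = k ∧ j = l) ∨ (i = l ∧ j = k) := by
  have hmem : ∀ a b : Fin 6, a ≤ b → (a, b) ∈ (↑(Finset.univ.filter fun p : Fin 6 × Fin 6 => p.1 ≤ p.2) : Set (Fin 6 × Fin 6)) := fun a b h =>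
    Finset.mem_coe.mpr (mem_pairDom h)
  intro i j k l h
  rcases le_total i j with hij | hij <;> rcases le_total k l with hkl | hkl
  · have e := hinj (hmem i j hij) (hmem k l hkl) h
    exact Or.inl ⟨congrArg Prod.fst e, congrArg Prod.snd e⟩
  · have e := hinj (hmem i j hij) (hmem l k hkl) (h.trans (hsymm k l))
    exact Or.inr ⟨congrArg Prod.fst e, congrArg Prod.snd e⟩
  · have e := hinj (hmem j i hij) (hmem k l hkl) ((hsymm j i).trans h)
    exact Or.inr ⟨congrArg Prod.snd e, congrArg Prod.fst e⟩
  · have e := hinj (hmem j i hij) (hmem l k hkl) ((hsymm j i).trans (h.trans (hsymm k l)))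
    exact Or.inl ⟨congrArg Prod.snd e, congrArg Prod.fst e⟩

/-- **Sorted enumeration of a Sidon pair-sum table.**  If the symmetric table `s i j` (values in a linear order) takes
distinct values on distinct unordered pairs, then its `21` values sort as a strictly increasing `E : Fin 21 → β` with a
symmetric, surjective position map `σ` (`E (σ i j) = s i j`). [folklore] -/
theorem exists_sortedEnum {β : Type*} [LinearOrder β] (s : Fin 6 → Fin 6 → β) (hsymm : ∀ i j, s i j = s j i)
    (hinj : ∀ i j k l, s i j = s k l → (i = k ∧ j = l) ∨ (i = l ∧ j = k)) :
    ∃ (E : Fin 21 → β) (σ : Fin 6 → Fin 6 → Fin 21), StrictMono E ∧ (∀ i j, σ i j = σ j i) ∧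
      (∀ i j, E (σ i j) = s i j) ∧ (∀ k, ∃ i j, σ i j = k) := by
  classical
  set T : Finset β := (Finset.univ.filter fun p : Fin 6 × Fin 6 => p.1 ≤ p.2).image (fun p : Fin 6 × Fin 6 => s p.1 p.2) with hT
  have hinjOn : Set.InjOn (fun p : Fin 6 × Fin 6 => s p.1 p.2) ↑(Finset.univ.filter fun p : Fin 6 × Fin 6 => p.1 ≤ p.2) := by
    intro p hp q hq hpq
    have hp' : p.1 ≤ p.2 := (Finset.mem_filter.mp (Finset.mem_coe.mp hp)).2
    have hq' : q.1 ≤ q.2 := (Finset.mem_filter.mp (Finset.mem_coe.mp hq)).2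
    rcases hinj _ _ _ _ hpq with ⟨h1, h2⟩ | ⟨h1, h2⟩
    · exact Prod.ext h1 h2
    · have h3 : p.2 ≤ p.1 := by rw [h1, h2]; exact hq'
      have h4 : p.1 = p.2 := le_antisymm hp' h3
      exact Prod.ext (h4.trans h2) (h4.symm.trans h1)
  have hcard : T.card = 21 := by rw [hT, Finset.card_image_of_injOn hinjOn, card_pairDom]
  have hmem : ∀ i j, s i j ∈ T := by
    intro i j
    rcases le_total i j with h | h
    · exact Finset.mem_image.mpr ⟨(i, j), mem_pairDom h, rfl⟩
    · exact Finset.mem_image.mpr ⟨(j, i), mem_pairDom h, hsymm j i⟩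
  refine ⟨fun k => T.orderEmbOfFin hcard k, fun i j => (T.orderIsoOfFin hcard).symm ⟨s i j, hmem i j⟩,
    (T.orderEmbOfFin hcard).strictMono, ?_, ?_, ?_⟩
  · intro i j
    have e : (⟨s i j, hmem i j⟩ : T) = ⟨s j i, hmem j i⟩ := Subtype.ext (hsymm i j)
    dsimp only
    rw [e]
  · intro i j
    dsimp only
    rw [← Finset.coe_orderIsoOfFin_apply, OrderIso.apply_symm_apply]
  · intro k
    obtain ⟨p, -, hpk⟩ := Finset.mem_image.mp (Finset.orderEmbOfFin_mem T hcard k)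
    refine ⟨p.1, p.2, ?_⟩
    rw [OrderIso.symm_apply_eq]
    exact Subtype.ext (by rw [Finset.coe_orderIsoOfFin_apply]; exact hpk)

/-! ### 2. Coefficients and support of the quadratic-form fewnomial `gramPoly d M` -/

/-- Coefficient formula: `coeff (gramPoly d M) n = Σ_{i,j : dᵢ+dⱼ = n} M i j`. [folklore] -/
theorem gramPoly_coeff (d : Fin 6 → ℕ) (M : Matrix (Fin 6) (Fin 6) ℝ) (n : ℕ) :
    (gramPoly d M).coeff n = ∑ i, ∑ j, if n = d i + d j then M i j else 0 := by
  simp only [gramPoly, finsetSum_coeff, coeff_C_mul_X_pow]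

/-- The support of `gramPoly d M` lies in the set of pair sums `dᵢ + dⱼ`, `i ≤ j` (at most `21` monomials). [folklore] -/
theorem gramPoly_support_subset (d : Fin 6 → ℕ) (M : Matrix (Fin 6) (Fin 6) ℝ) :
    (gramPoly d M).support ⊆ (Finset.univ.filter fun p : Fin 6 × Fin 6 => p.1 ≤ p.2).image (fun p : Fin 6 × Fin 6 => d p.1 + d p.2) := by
  intro n hn
  rw [mem_support_iff, gramPoly_coeff] at hn
  obtain ⟨i, -, hi⟩ := Finset.exists_ne_zero_of_sum_ne_zero hn
  obtain ⟨j, -, hj⟩ := Finset.exists_ne_zero_of_sum_ne_zero hi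
  have hn' : n = d i + d j := by
    by_contra h
    exact hj (if_neg h)
  rcases le_total i j with h | h
  · exact Finset.mem_image.mpr ⟨(i, j), mem_pairDom h, hn'.symm⟩
  · exact Finset.mem_image.mpr ⟨(j, i), mem_pairDom h, by rw [hn', add_comm]⟩

/-- On a Sidon support the coefficient of `X^{dᵢ+dⱼ}` in `gramPoly d M` (`M` symmetric) is `M i i` on the diagonal and
`2 M i j` off it. [folklore] -/
theorem gramPoly_coeff_pairSum (d : Fin 6 → ℕ) (M : Matrix (Fin 6) (Fin 6) ℝ) (hM : M.IsSymm)
    (hsidon : ∀ i j k l, d i + d j = d k + d l → (i = k ∧ j = l) ∨ (i = l ∧ j = k)) (i j : Fin 6) :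
    (gramPoly d M).coeff (d i + d j) = if i = j then M i j else 2 * M i j := by
  classical
  rw [gramPoly_coeff, ← Fintype.sum_prod_type', ← Finset.sum_filter]
  have hset : (Finset.univ.filter fun p : Fin 6 × Fin 6 => d i + d j = d p.1 + d p.2) = {(i, j), (j, i)} := by
    ext p
    simp only [Finset.mem_filter, Finset.mem_univ, true_and, Finset.mem_insert, Finset.mem_singleton]
    constructor
    · intro h
      rcases hsidon i j p.1 p.2 h with ⟨h1, h2⟩ | ⟨h1, h2⟩
      · exact Or.inl (Prod.ext h1.symm h2.symm)
      · exact Or.inr (Prod.ext h2.symm h1.symm)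
    · rintro (rfl | rfl)
      · rfl
      · exact add_comm _ _
  rw [hset]
  by_cases hij : i = j
  · subst hij
    rw [if_pos rfl, Finset.pair_eq_singleton, Finset.sum_singleton]
  · have hne : (i, j) ≠ (j, i) := fun e => hij (congrArg Prod.fst e)
    rw [if_neg hij, Finset.sum_pair hne, hM.apply i j]
    ring

/-! ### 3. The stub -/

/-- **Stub `stub_extremalInverse` of line «extremal-inverse» (crux `DoorA26`, stmt-ValiantsHypothesis-19979), verbatim:
extremal inverse = Chebyshev/Cramer.**  If the quadratic-form fewnomial `gramPoly d M` of a symmetric `M` on the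
support `d` has at least twenty distinct positive roots then: (Descartes, `≤ 21` monomials) its support has exactly `21`
elements, so the pair sums `dᵢ + dⱼ` (`i ≤ j`) are pairwise distinct and sort as a strictly increasing `E` with symmetric
surjective position map `σ`; and (root-side parametrization of a Descartes-sharp fewnomial,
`Literature.Analysis.TotalPositivity.exists_roots_coeff_eq_mul_signedMinor` — Gantmacher's generalized Vandermonde /
Pinkus's T-systems) there are sorted positive roots `r₀ < ⋯ < r₁₉` and `c ≠ 0` with
`coeff (E u) = c · (−1)^u · minor_u(r)`, i.e. `M = extremalGram E σ r c` (diagonal coefficient `M i i`, off-diagonal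
`2 M i j`). [folklore] -/
theorem stub_extremalInverse :
    ∀ (d : Fin 6 → ℕ) (M : Matrix (Fin 6) (Fin 6) ℝ), M.IsSymm →
      19 < ((gramPoly d M).roots.toFinset.filter (fun t => 0 < t)).card →
      ∃ (E : Fin 21 → ℕ) (σ : Fin 6 → Fin 6 → Fin 21) (r : Fin 20 → ℝ) (c : ℝ),
        StrictMono E ∧ (∀ i j, σ i j = σ j i) ∧ (∀ i j, E (σ i j) = d i + d j) ∧ (∀ k, ∃ i j, σ i j = k) ∧
        StrictMono r ∧ 0 < r 0 ∧ c ≠ 0 ∧ M = extremalGram E σ r c := by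
  classical
  intro d M hM hZ
  -- `gramPoly d M ≠ 0` (the zero polynomial has no roots)
  have hf : gramPoly d M ≠ 0 := by
    intro h
    rw [h, roots_zero, Multiset.toFinset_zero, Finset.filter_empty, Finset.card_empty] at hZ
    exact Nat.not_lt_zero _ hZ
  -- Descartes: `21 ≤ #support ≤ #pair sums ≤ 21`, so the pair-sum map is injective on ordered pairs (Sidon)
  have hdesc := Literature.Computability.AlgebraicComplexity.card_roots_toFinset_filter_pos_lt_card_support hf
  have hsub := gramPoly_support_subset d M
  have hTle : ((Finset.univ.filter fun p : Fin 6 × Fin 6 => p.1 ≤ p.2).image (fun p : Fin 6 × Fin 6 => d p.1 + d p.2)).card ≤ (Finset.univ.filter fun p : Fin 6 × Fin 6 => p.1 ≤ p.2).card :=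
    Finset.card_image_le
  have hTcard : ((Finset.univ.filter fun p : Fin 6 × Fin 6 => p.1 ≤ p.2).image (fun p : Fin 6 × Fin 6 => d p.1 + d p.2)).card = (Finset.univ.filter fun p : Fin 6 × Fin 6 => p.1 ≤ p.2).card := by
    have h1 := Finset.card_le_card hsub
    rw [card_pairDom] at hTle ⊢
    omega
  have hinjOn : Set.InjOn (fun p : Fin 6 × Fin 6 => d p.1 + d p.2) ↑(Finset.univ.filter fun p : Fin 6 × Fin 6 => p.1 ≤ p.2) := Finset.card_image_iff.mp hTcard
  have hsidon : ∀ i j k l, d i + d j = d k + d l → (i = k ∧ j = l) ∨ (i = l ∧ j = k) :=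
    sidon_of_injOn (fun i j => d i + d j) (fun i j => add_comm _ _) hinjOn
  -- sorted enumeration of the 21 pair sums
  obtain ⟨E, σ, hE, hσ, hEσ, hsurj⟩ := exists_sortedEnum (fun i j => d i + d j) (fun i j => add_comm _ _) hsidon
  have hsupp : (gramPoly d M).support ⊆ Finset.univ.image E := by
    intro n hn
    obtain ⟨p, -, hp⟩ := Finset.mem_image.mp (hsub hn)
    exact Finset.mem_image.mpr ⟨σ p.1 p.2, Finset.mem_univ _, (hEσ p.1 p.2).trans hp⟩
  -- root-side parametrization (generalized Vandermonde has positive maximal minors; one-dimensional kernel)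
  obtain ⟨ρ, hρ0, hρ, -, t, ht, hcoeff⟩ :=
    Literature.Analysis.TotalPositivity.exists_roots_coeff_eq_mul_signedMinor (gramPoly d M) hf E hE hsupp
      (by omega)
  refine ⟨E, σ, ρ, t, hE, hσ, hEσ, hsurj, hρ, hρ0 0, ht, ?_⟩
  ext i j
  have h1 := hcoeff (σ i j)
  rw [hEσ, gramPoly_coeff_pairSum d M hM hsidon] at h1
  simp only [extremalGram, vdmMinor, Matrix.of_apply]
  by_cases hij : i = j
  · rw [if_pos hij] at h1
    rw [if_pos hij, div_one, h1]
    ring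
  · rw [if_neg hij] at h1
    rw [if_neg hij]
    have h2 : M i j = (2 * M i j) / 2 := by ring
    rw [h2, h1]
    ring

end Summit.ValiantsHypothesis.ValiantsHypothesis.Theorems.LacunarySymmetroid.DoorA26.ExtremalInverse

/-! ## Appended 2026-08-28 (same seat): strict alternation of a would-be Gram, in matrix form

The parity pre-sieve of the line card reads signs off positions: by Gantmacher's positivity of the generalized Vandermonde minors
(`Literature.Analysis.TotalPositivity.maximalMinor_pos`) every entry of a would-be Gram `extremalGram E σ r c` at sorted positive
roots is NONZERO with sign `sign(c) · (−1)^{σ i j}`. -/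

namespace Summit.ValiantsHypothesis.ValiantsHypothesis.Theorems.LacunarySymmetroid.DoorA26.ExtremalInverse

/-- The maximal minors of the generalized Vandermonde at sorted positive roots with sorted exponents are positive
(`maximalMinor_pos`, in the line's notation `vdmMinor`). [folklore] -/
theorem vdmMinor_pos (r : Fin 20 → ℝ) (E : Fin 21 → ℕ) (hE : StrictMono E) (hr : StrictMono r) (hr0 : 0 < r 0)
    (k : Fin 21) : 0 < vdmMinor r E k :=
  Literature.Analysis.TotalPositivity.maximalMinor_pos r E
    (fun a => lt_of_lt_of_le hr0 (hr.monotone (Fin.zero_le a))) hr hE k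

/-- **Strict alternation in matrix form.**  Every entry of a would-be Gram `extremalGram E σ r c` (`E` and `r` strictly
increasing, `r > 0`, `c ≠ 0`) is nonzero with sign `sign(c) · (−1)^{σ i j}`:  `0 < c · (−1)^{σ i j} · (extremalGram E σ r c) i j`.
In particular the entries at even positions have the sign of `c`, those at odd positions the opposite sign (the input of the
line card's parity pre-sieve). [folklore] -/
theorem mul_extremalGram_entry_pos (E : Fin 21 → ℕ) (σ : Fin 6 → Fin 6 → Fin 21) (r : Fin 20 → ℝ) (c : ℝ)
    (hE : StrictMono E) (hr : StrictMono r) (hr0 : 0 < r 0) (hc : c ≠ 0) (i j : Fin 6) :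
    0 < c * (-1 : ℝ) ^ ((σ i j : Fin 21) : ℕ) * extremalGram E σ r c i j := by
  have hV := vdmMinor_pos r E hE hr hr0 (σ i j)
  have hden : (0 : ℝ) < (if i = j then 1 else 2) := by split_ifs <;> norm_num
  have hsq : ((-1 : ℝ) ^ ((σ i j : Fin 21) : ℕ)) * (-1 : ℝ) ^ ((σ i j : Fin 21) : ℕ) = 1 := by
    rw [← pow_add, ← two_mul, pow_mul]
    norm_num
  have hc2 : 0 < c * c := mul_self_pos.mpr hc
  simp only [extremalGram, Matrix.of_apply]
  have key : c * (-1 : ℝ) ^ ((σ i j : Fin 21) : ℕ) *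
      (c * (-1 : ℝ) ^ ((σ i j : Fin 21) : ℕ) * vdmMinor r E (σ i j) / (if i = j then 1 else 2))
      = (c * c) * (((-1 : ℝ) ^ ((σ i j : Fin 21) : ℕ)) * (-1 : ℝ) ^ ((σ i j : Fin 21) : ℕ)) * vdmMinor r E (σ i j) /
        (if i = j then 1 else 2) := by
    ring
  rw [key, hsq, mul_one]
  exact div_pos (mul_pos hc2 hV) hden

/-- Every entry of a would-be Gram is nonzero. [folklore] -/
theorem extremalGram_entry_ne_zero (E : Fin 21 → ℕ) (σ : Fin 6 → Fin 6 → Fin 21) (r : Fin 20 → ℝ) (c : ℝ)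
    (hE : StrictMono E) (hr : StrictMono r) (hr0 : 0 < r 0) (hc : c ≠ 0) (i j : Fin 6) :
    extremalGram E σ r c i j ≠ 0 := by
  intro h
  have := mul_extremalGram_entry_pos E σ r c hE hr hr0 hc i j
  rw [h, mul_zero] at this
  exact lt_irrefl _ this

end Summit.ValiantsHypothesis.ValiantsHypothesis.Theorems.LacunarySymmetroid.DoorA26.ExtremalInverse
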